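import Literature.AlgebraicGeometry.Motives.MixedHodgeExtensionHomFunctor
import Literature.AlgebraicGeometry.Motives.MixedHodgeExtensionTensorHomAdjunctionNaturality
import Literature.AlgebraicGeometry.Motives.MixedHodgeExtensionTensorTate
import Literature.AlgebraicGeometry.Motives.MixedHodgeStructureInternalHomUnit
import HarnessLib

/-!
# `Hom(C, E)` and `Hom(E, C)`: naturality in `C`, the curry isomorphisms, and `Hom(ℚ(0), E) ≅ E`

Deligne, *Théorie de Hodge II*, 1.1.12: the internal `Hom` of (mixed Hodge / bifiltered) objects is a
bifunctor, compatible with composition of the functors `Hom`, `⊗` ("compatibles à la composition des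
foncteurs"); Deligne–Milne, *Tannakian categories*, §1 (1.6.1)–(1.6.4): `Hom(T ⊗ X, Y) ≅ Hom(T, Hom(X, Y))`
functorially, `Hom(Z, Hom(X, Y)) ≅ Hom(Z ⊗ X, Y)` (1.6.3), `Hom(1, Hom(X, Y)) = Hom(X, Y)` (1.6.4). Mac Lane,
*Homology* III Prop. 1.8: along a morphism of extensions `(β, φ, α) : E → E'`, `β_* E ≡ α^* E'`.

For an extension `E : 0 → B → E → A → 0` of mixed Hodge structures (finite-dimensional carriers) the file
`MixedHodgeExtensionHomFunctor` constructs `Hom(C, E)` and `Hom(E, C)` functorially in `E`. This file adds: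

* §1 **naturality in `C`**: a morphism `h : C' → C` induces the morphism of extensions
  `Hom(h, E) : Hom(C, E) → Hom(C', E)` over `Hom(h, B)`, `Hom(h, A)` (`Extension.homLeftPrecomp`), and
  `g : C → C'` induces `Hom(E, g) : Hom(E, C) → Hom(E, C')` (`Extension.homRightPostcomp`); on `Ext`:
  **`Hom(h, B)_* Hom(C, x) = Hom(h, A)^* Hom(C', x)`** and **`Hom(A, g)_* Hom(x, C) = Hom(B, g)^* Hom(x, C')`**
  (dinaturality), with the transport formulas along an isomorphism `h`;
* §2 **the curry isomorphisms of extensions** `Hom(C ⊗ C', E) → Hom(C, Hom(C', E))` and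
  `Hom(E ⊗ C, C'') → Hom(E, Hom(C, C''))` (components `homTensorCurry`), hence on `Ext`:
  `curry_* Hom(C ⊗ C', x) = curry^* Hom(C, Hom(C', x))`, **`Hom(C, Hom(C', x)) = uncurry^* curry_* Hom(C ⊗ C', x)`**,
  `curry_* Hom(x ⊗ C, C'') = curry^* Hom(x, Hom(C, C''))`, **`Hom(x, Hom(C, C'')) = uncurry^* curry_* Hom(x ⊗ C, C'')`**;
* §3 **`Hom(ℚ(0), E) ≅ E`**: the morphism of extensions `Hom(ℚ(0), E) → E` over `f ↦ f(1)`
  (`unitHomEval`), so `(≅)_* Hom(ℚ(0), x) = (≅)^* x`, `Hom(ℚ(0), x) = (≅)^* (≅⁻¹)_* x`, and `Hom(ℚ(0), x)`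
  splits iff `x` splits.

All statements proved; no named facts.

## References

* [DeligneHodgeII1971] P. Deligne, Théorie de Hodge II, 1.1.12.
* [DeligneMilne1982Tannakian] P. Deligne, J. S. Milne, Tannakian categories, LNM 900 (1982), §1
  (1.6.1), (1.6.3), (1.6.4).
* [MacLane1963Homology] S. Mac Lane, Homology (1963), Ch. III §1 Lemmas 1.2, 1.4, Prop. 1.8.
* [Carlson1980] J. A. Carlson, Extensions of mixed Hodge structures (1980), §2(b) Prop. 1.
-/

noncomputable section

open scoped TensorProduct

namespace Literature.AlgebraicGeometry.Motives

namespace MixedHodgeStructure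

open HodgeStructure (tate)

variable {VA : Type*} [AddCommGroup VA] [Module ℚ VA] [FiniteDimensional ℚ VA]
variable {VB : Type*} [AddCommGroup VB] [Module ℚ VB] [FiniteDimensional ℚ VB]
variable {VC : Type*} [AddCommGroup VC] [Module ℚ VC] [FiniteDimensional ℚ VC]
variable {VC' : Type*} [AddCommGroup VC'] [Module ℚ VC'] [FiniteDimensional ℚ VC']

/-! ### §1 Naturality of `Hom(C, E)` and `Hom(E, C)` in `C` -/

section NaturalityC

variable {VE : Type*} [AddCommGroup VE] [Module ℚ VE] [FiniteDimensional ℚ VE]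
variable {A : MixedHodgeStructure VA} {B : MixedHodgeStructure VB}
variable {C : MixedHodgeStructure VC} {C' : MixedHodgeStructure VC'}

namespace Extension

variable (E : Extension A B VE)

/-- **`Hom(h, E) : Hom(C, E) → Hom(C', E)` for `h : C' → C`**, the morphism of extensions with components
`Hom(h, B)`, `Hom(h, E)`, `Hom(h, A)` (the internal Hom is a bifunctor: `Hom(h, E) ∘ Hom(C, i) = Hom(h, i) =
Hom(C', i) ∘ Hom(h, B)`). [cite: DeligneHodgeII1971, 1.1.12] -/
def homLeftPrecomp (h : Hom C' C) : Morphism (E.homLeft C) (E.homLeft C') where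
  left := Hom.homMap h (Hom.id B)
  mid := Hom.homMap h (Hom.id E.mhs)
  right := Hom.homMap h (Hom.id A)
  mid_inc := by
    change (Hom.homMap h (Hom.id E.mhs)).toLinearMap ∘ₗ (Hom.homMap (Hom.id C) E.inc).toLinearMap =
      (Hom.homMap (Hom.id C') E.inc).toLinearMap ∘ₗ (Hom.homMap h (Hom.id B)).toLinearMap
    refine LinearMap.ext fun φ => ?_
    simp only [LinearMap.comp_apply, Hom.homMap_toLinearMap_apply, Hom.id_toLinearMap, LinearMap.comp_id,
      LinearMap.id_comp, LinearMap.comp_assoc]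
  proj_mid := by
    change (Hom.homMap (Hom.id C') E.proj).toLinearMap ∘ₗ (Hom.homMap h (Hom.id E.mhs)).toLinearMap =
      (Hom.homMap h (Hom.id A)).toLinearMap ∘ₗ (Hom.homMap (Hom.id C) E.proj).toLinearMap
    refine LinearMap.ext fun φ => ?_
    simp only [LinearMap.comp_apply, Hom.homMap_toLinearMap_apply, Hom.id_toLinearMap, LinearMap.comp_id,
      LinearMap.id_comp, LinearMap.comp_assoc]

/-- Components of `Hom(h, E)` (by `rfl`). [cite: DeligneHodgeII1971, 1.1.12] -/
@[simp]
theorem homLeftPrecomp_left (h : Hom C' C) : (E.homLeftPrecomp h).left = Hom.homMap h (Hom.id B) := rfl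

/-- Components of `Hom(h, E)` (by `rfl`). [cite: DeligneHodgeII1971, 1.1.12] -/
@[simp]
theorem homLeftPrecomp_mid (h : Hom C' C) : (E.homLeftPrecomp h).mid = Hom.homMap h (Hom.id E.mhs) := rfl

/-- Components of `Hom(h, E)` (by `rfl`). [cite: DeligneHodgeII1971, 1.1.12] -/
@[simp]
theorem homLeftPrecomp_right (h : Hom C' C) : (E.homLeftPrecomp h).right = Hom.homMap h (Hom.id A) := rfl

/-- **`Hom(E, g) : Hom(E, C) → Hom(E, C')` for `g : C → C'`**, the morphism of extensions with components
`Hom(A, g)`, `Hom(E, g)`, `Hom(B, g)`. [cite: DeligneHodgeII1971, 1.1.12] -/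
def homRightPostcomp (g : Hom C C') : Morphism (E.homRight C) (E.homRight C') where
  left := Hom.homMap (Hom.id A) g
  mid := Hom.homMap (Hom.id E.mhs) g
  right := Hom.homMap (Hom.id B) g
  mid_inc := by
    change (Hom.homMap (Hom.id E.mhs) g).toLinearMap ∘ₗ (Hom.homMap E.proj (Hom.id C)).toLinearMap =
      (Hom.homMap E.proj (Hom.id C')).toLinearMap ∘ₗ (Hom.homMap (Hom.id A) g).toLinearMap
    refine LinearMap.ext fun φ => ?_
    simp only [LinearMap.comp_apply, Hom.homMap_toLinearMap_apply, Hom.id_toLinearMap, LinearMap.comp_id,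
      LinearMap.id_comp, LinearMap.comp_assoc]
  proj_mid := by
    change (Hom.homMap E.inc (Hom.id C')).toLinearMap ∘ₗ (Hom.homMap (Hom.id E.mhs) g).toLinearMap =
      (Hom.homMap (Hom.id B) g).toLinearMap ∘ₗ (Hom.homMap E.inc (Hom.id C)).toLinearMap
    refine LinearMap.ext fun φ => ?_
    simp only [LinearMap.comp_apply, Hom.homMap_toLinearMap_apply, Hom.id_toLinearMap, LinearMap.comp_id,
      LinearMap.id_comp, LinearMap.comp_assoc]

/-- Components of `Hom(E, g)` (by `rfl`). [cite: DeligneHodgeII1971, 1.1.12] -/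
@[simp]
theorem homRightPostcomp_left (g : Hom C C') : (E.homRightPostcomp g).left = Hom.homMap (Hom.id A) g := rfl

/-- Components of `Hom(E, g)` (by `rfl`). [cite: DeligneHodgeII1971, 1.1.12] -/
@[simp]
theorem homRightPostcomp_mid (g : Hom C C') : (E.homRightPostcomp g).mid = Hom.homMap (Hom.id E.mhs) g := rfl

/-- Components of `Hom(E, g)` (by `rfl`). [cite: DeligneHodgeII1971, 1.1.12] -/
@[simp]
theorem homRightPostcomp_right (g : Hom C C') : (E.homRightPostcomp g).right = Hom.homMap (Hom.id B) g := rfl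

/-- **`Hom(h, B)_* Hom(C, E) ≡ Hom(h, A)^* Hom(C', E)`** (Mac Lane III Prop. 1.8 along `Hom(h, E)`).
[cite: MacLane1963Homology, Ch. III Prop. 1.8] -/
theorem nonempty_congruence_homLeft_pushout_homLeft_pullback (h : Hom C' C) :
    Nonempty (Congruence ((E.homLeft C).pushout (Hom.homMap h (Hom.id B)))
      ((E.homLeft C').pullback (Hom.homMap h (Hom.id A)))) :=
  nonempty_congruence_pushout_pullback_of_morphism (E.homLeftPrecomp h)

/-- **`Hom(A, g)_* Hom(E, C) ≡ Hom(B, g)^* Hom(E, C')`** (Mac Lane III Prop. 1.8 along `Hom(E, g)`).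
[cite: MacLane1963Homology, Ch. III Prop. 1.8] -/
theorem nonempty_congruence_homRight_pushout_homRight_pullback (g : Hom C C') :
    Nonempty (Congruence ((E.homRight C).pushout (Hom.homMap (Hom.id A) g))
      ((E.homRight C').pullback (Hom.homMap (Hom.id B) g))) :=
  nonempty_congruence_pushout_pullback_of_morphism (E.homRightPostcomp g)

/-- In the complete invariant: `Hom(h, B)_* [Hom(C, E)]_W = Hom(h, A)^* [Hom(C', E)]_W`.
[cite: MacLane1963Homology, Ch. III Prop. 1.8] [cite: Carlson1980, §2(b) Prop. 1] -/
theorem postcomp_clsW_homLeft_eq_precomp_clsW_homLeft (h : Hom C' C) :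
    JHomW.postcomp (hom C A) (Hom.homMap h (Hom.id B)) (E.homLeft C).clsW =
      JHomW.precomp (hom C' B) (Hom.homMap h (Hom.id A)) (E.homLeft C').clsW :=
  (E.homLeftPrecomp h).postcomp_clsW_eq_precomp_clsW

/-- In the complete invariant: `Hom(A, g)_* [Hom(E, C)]_W = Hom(B, g)^* [Hom(E, C')]_W`.
[cite: MacLane1963Homology, Ch. III Prop. 1.8] [cite: Carlson1980, §2(b) Prop. 1] -/
theorem postcomp_clsW_homRight_eq_precomp_clsW_homRight (g : Hom C C') :
    JHomW.postcomp (hom B C) (Hom.homMap (Hom.id A) g) (E.homRight C).clsW =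
      JHomW.precomp (hom A C') (Hom.homMap (Hom.id B) g) (E.homRight C').clsW :=
  (E.homRightPostcomp g).postcomp_clsW_eq_precomp_clsW

end Extension

namespace Ext

/-- **Dinaturality of `Hom(·, x)`: `Hom(h, B)_* Hom(C, x) = Hom(h, A)^* Hom(C', x)`** on `Ext`, for `h : C' → C`.
[cite: DeligneHodgeII1971, 1.1.12] [cite: MacLane1963Homology, Ch. III Prop. 1.8] -/
theorem pushoutMapW_homMap_homLeftMap (h : Hom C' C) (x : Ext A B) :
    pushoutMapW (Hom.homMap h (Hom.id B)) (homLeftMap C x) =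
      pullbackMapW (Hom.homMap h (Hom.id A)) (homLeftMap C' x) := by
  obtain ⟨E, rfl⟩ := exists_mkOfW_eq x
  rw [homLeftMap_mkOfW, homLeftMap_mkOfW]
  exact pushoutMapW_mkOfW_eq_pullbackMapW_mkOfW (E.homLeftPrecomp h)

/-- **Dinaturality of `Hom(x, ·)`: `Hom(A, g)_* Hom(x, C) = Hom(B, g)^* Hom(x, C')`** on `Ext`, for `g : C → C'`.
[cite: DeligneHodgeII1971, 1.1.12] [cite: MacLane1963Homology, Ch. III Prop. 1.8] -/
theorem pushoutMapW_homMap_homRightMap (g : Hom C C') (x : Ext A B) :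
    pushoutMapW (Hom.homMap (Hom.id A) g) (homRightMap C x) =
      pullbackMapW (Hom.homMap (Hom.id B) g) (homRightMap C' x) := by
  obtain ⟨E, rfl⟩ := exists_mkOfW_eq x
  rw [homRightMap_mkOfW, homRightMap_mkOfW]
  exact pushoutMapW_mkOfW_eq_pullbackMapW_mkOfW (E.homRightPostcomp g)

/-- **Transport along an isomorphism `h : C' ≅ C`**: `Hom(C', x) = Hom(h⁻¹, A)^* Hom(h, B)_* Hom(C, x)`.
[cite: DeligneHodgeII1971, 1.1.12] [cite: MacLane1963Homology, Ch. III §1] -/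
theorem homLeftMap_eq_of_bijective (h : Hom C' C) (hh : Function.Bijective h.toLinearMap) (x : Ext A B) :
    homLeftMap C' x =
      pullbackMapW (Hom.homMap (h.inverse hh) (Hom.id A))
        (pushoutMapW (Hom.homMap h (Hom.id B)) (homLeftMap C x)) := by
  rw [pushoutMapW_homMap_homLeftMap, ← pullbackMapW_comp, ← Hom.homMap_comp, Hom.inverse_comp, Hom.id_comp_id,
    Hom.homMap_id, pullbackMapW_id]

/-- **Transport along an isomorphism `g : C ≅ C'`**: `Hom(x, C') = Hom(B, g⁻¹)^* Hom(A, g)_* Hom(x, C)`.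
[cite: DeligneHodgeII1971, 1.1.12] [cite: MacLane1963Homology, Ch. III §1] -/
theorem homRightMap_eq_of_bijective (g : Hom C C') (hg : Function.Bijective g.toLinearMap) (x : Ext A B) :
    homRightMap C' x =
      pullbackMapW (Hom.homMap (Hom.id B) (g.inverse hg))
        (pushoutMapW (Hom.homMap (Hom.id A) g) (homRightMap C x)) := by
  rw [pushoutMapW_homMap_homRightMap, ← pullbackMapW_comp, ← Hom.homMap_comp, Hom.comp_inverse, Hom.id_comp_id,
    Hom.homMap_id, pullbackMapW_id]

end Ext

end NaturalityC

/-! ### §2 The curry isomorphisms `Hom(C ⊗ C', E) ≅ Hom(C, Hom(C', E))` and `Hom(E ⊗ C, C'') ≅ Hom(E, Hom(C, C''))` -/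

section Curry

variable {VE : Type*} [AddCommGroup VE] [Module ℚ VE] [FiniteDimensional ℚ VE]
variable {A : MixedHodgeStructure VA} {B : MixedHodgeStructure VB}

namespace Extension

variable (E : Extension A B VE) (C : MixedHodgeStructure VC) (C' : MixedHodgeStructure VC')

/-- **The curry isomorphism of extensions `Hom(C ⊗ C', E) → Hom(C, Hom(C', E))`** (components
`homTensorCurry`; the squares commute by naturality of currying in the target).
[cite: DeligneMilne1982Tannakian, §1 (1.6.3)] [cite: DeligneHodgeII1971, 1.1.12] -/
def homLeftTensorToHomLeftHomLeft : Morphism (E.homLeft (tensor C C')) ((E.homLeft C').homLeft C) where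
  left := homTensorCurry C C' B
  mid := homTensorCurry C C' E.mhs
  right := homTensorCurry C C' A
  mid_inc := by
    change (homTensorCurry C C' E.mhs).toLinearMap ∘ₗ (Hom.homMap (Hom.id (tensor C C')) E.inc).toLinearMap =
      (Hom.homMap (Hom.id C) (Hom.homMap (Hom.id C') E.inc)).toLinearMap ∘ₗ (homTensorCurry C C' B).toLinearMap
    rw [← Hom.comp_toLinearMap, ← Hom.comp_toLinearMap, homTensorCurry_comp_homMap_right]
  proj_mid := by
    change (Hom.homMap (Hom.id C) (Hom.homMap (Hom.id C') E.proj)).toLinearMap ∘ₗ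
        (homTensorCurry C C' E.mhs).toLinearMap =
      (homTensorCurry C C' A).toLinearMap ∘ₗ (Hom.homMap (Hom.id (tensor C C')) E.proj).toLinearMap
    rw [← Hom.comp_toLinearMap, ← Hom.comp_toLinearMap, homTensorCurry_comp_homMap_right]

/-- Components of the curry isomorphism (by `rfl`). [cite: DeligneMilne1982Tannakian, §1 (1.6.3)] -/
@[simp]
theorem homLeftTensorToHomLeftHomLeft_left :
    (E.homLeftTensorToHomLeftHomLeft C C').left = homTensorCurry C C' B := rfl

/-- Components of the curry isomorphism (by `rfl`). [cite: DeligneMilne1982Tannakian, §1 (1.6.3)] -/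
@[simp]
theorem homLeftTensorToHomLeftHomLeft_right :
    (E.homLeftTensorToHomLeftHomLeft C C').right = homTensorCurry C C' A := rfl

/-- **`curry_* Hom(C ⊗ C', E) ≡ curry^* Hom(C, Hom(C', E))`.** [cite: MacLane1963Homology, Ch. III Prop. 1.8]
[cite: DeligneMilne1982Tannakian, §1 (1.6.3)] -/
theorem nonempty_congruence_homLeft_tensor_pushout_homLeft_homLeft_pullback :
    Nonempty (Congruence ((E.homLeft (tensor C C')).pushout (homTensorCurry C C' B))
      (((E.homLeft C').homLeft C).pullback (homTensorCurry C C' A))) :=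
  nonempty_congruence_pushout_pullback_of_morphism (E.homLeftTensorToHomLeftHomLeft C C')

variable (C'' : MixedHodgeStructure VC')

/-- **The curry isomorphism of extensions `Hom(E ⊗ C, C'') → Hom(E, Hom(C, C''))`** (components
`homTensorCurry`; squares by naturality of currying in the first tensor factor).
[cite: DeligneMilne1982Tannakian, §1 (1.6.3)] [cite: DeligneHodgeII1971, 1.1.12] -/
def rTensorHomRightToHomRightHom : Morphism ((E.rTensor C).homRight C'') (E.homRight (hom C C'')) where
  left := homTensorCurry A C C''
  mid := homTensorCurry E.mhs C C''
  right := homTensorCurry B C C''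
  mid_inc := by
    change (homTensorCurry E.mhs C C'').toLinearMap ∘ₗ
        (Hom.homMap (E.proj.tensorMap (Hom.id C)) (Hom.id C'')).toLinearMap =
      (Hom.homMap E.proj (Hom.id (hom C C''))).toLinearMap ∘ₗ (homTensorCurry A C C'').toLinearMap
    rw [← Hom.comp_toLinearMap, ← Hom.comp_toLinearMap, homTensorCurry_comp_homMap_tensorMap_id]
  proj_mid := by
    change (Hom.homMap E.inc (Hom.id (hom C C''))).toLinearMap ∘ₗ (homTensorCurry E.mhs C C'').toLinearMap =
      (homTensorCurry B C C'').toLinearMap ∘ₗ (Hom.homMap (E.inc.tensorMap (Hom.id C)) (Hom.id C'')).toLinearMap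
    rw [← Hom.comp_toLinearMap, ← Hom.comp_toLinearMap, homTensorCurry_comp_homMap_tensorMap_id]

/-- Components of the curry isomorphism (by `rfl`). [cite: DeligneMilne1982Tannakian, §1 (1.6.3)] -/
@[simp]
theorem rTensorHomRightToHomRightHom_left :
    (E.rTensorHomRightToHomRightHom C C'').left = homTensorCurry A C C'' := rfl

/-- Components of the curry isomorphism (by `rfl`). [cite: DeligneMilne1982Tannakian, §1 (1.6.3)] -/
@[simp]
theorem rTensorHomRightToHomRightHom_right :
    (E.rTensorHomRightToHomRightHom C C'').right = homTensorCurry B C C'' := rfl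

/-- **`curry_* Hom(E ⊗ C, C'') ≡ curry^* Hom(E, Hom(C, C''))`.** [cite: MacLane1963Homology, Ch. III Prop. 1.8]
[cite: DeligneMilne1982Tannakian, §1 (1.6.3)] -/
theorem nonempty_congruence_rTensor_homRight_pushout_homRight_hom_pullback :
    Nonempty (Congruence (((E.rTensor C).homRight C'').pushout (homTensorCurry A C C''))
      ((E.homRight (hom C C'')).pullback (homTensorCurry B C C''))) :=
  nonempty_congruence_pushout_pullback_of_morphism (E.rTensorHomRightToHomRightHom C C'')

end Extension

namespace Ext

variable (C : MixedHodgeStructure VC) (C' : MixedHodgeStructure VC')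

/-- **`curry_* Hom(C ⊗ C', x) = curry^* Hom(C, Hom(C', x))`** on `Ext`. [cite: DeligneMilne1982Tannakian, §1 (1.6.3)]
[cite: MacLane1963Homology, Ch. III Prop. 1.8] -/
theorem pushoutMapW_homTensorCurry_homLeftMap_tensor (x : Ext A B) :
    pushoutMapW (homTensorCurry C C' B) (homLeftMap (tensor C C') x) =
      pullbackMapW (homTensorCurry C C' A) (homLeftMap C (homLeftMap C' x)) := by
  obtain ⟨E, rfl⟩ := exists_mkOfW_eq x
  rw [homLeftMap_mkOfW, homLeftMap_mkOfW, homLeftMap_mkOfW]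
  exact pushoutMapW_mkOfW_eq_pullbackMapW_mkOfW (E.homLeftTensorToHomLeftHomLeft C C')

/-- **`Hom(C, Hom(C', x)) = uncurry^* curry_* Hom(C ⊗ C', x)`.** [cite: DeligneMilne1982Tannakian, §1 (1.6.3)] -/
theorem homLeftMap_homLeftMap_eq (x : Ext A B) :
    homLeftMap C (homLeftMap C' x) =
      pullbackMapW (homTensorUncurry C C' A) (pushoutMapW (homTensorCurry C C' B) (homLeftMap (tensor C C') x)) := by
  rw [pushoutMapW_homTensorCurry_homLeftMap_tensor, ← pullbackMapW_comp, homTensorCurry_comp_homTensorUncurry,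
    pullbackMapW_id]

/-- **`Hom(C ⊗ C', x) = curry^* uncurry_* Hom(C, Hom(C', x))`.** [cite: DeligneMilne1982Tannakian, §1 (1.6.3)] -/
theorem homLeftMap_tensor_eq (x : Ext A B) :
    homLeftMap (tensor C C') x =
      pullbackMapW (homTensorCurry C C' A)
        (pushoutMapW (homTensorUncurry C C' B) (homLeftMap C (homLeftMap C' x))) := by
  rw [← pushoutMapW_pullbackMapW, ← pushoutMapW_homTensorCurry_homLeftMap_tensor, ← pushoutMapW_comp,
    homTensorUncurry_comp_homTensorCurry, pushoutMapW_id]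

variable (C'' : MixedHodgeStructure VC')

/-- **`curry_* Hom(x ⊗ C, C'') = curry^* Hom(x, Hom(C, C''))`** on `Ext`. [cite: DeligneMilne1982Tannakian, §1 (1.6.3)]
[cite: MacLane1963Homology, Ch. III Prop. 1.8] -/
theorem pushoutMapW_homTensorCurry_homRightMap_rTensorMap (x : Ext A B) :
    pushoutMapW (homTensorCurry A C C'') (homRightMap C'' (rTensorMap C x)) =
      pullbackMapW (homTensorCurry B C C'') (homRightMap (hom C C'') x) := by
  obtain ⟨E, rfl⟩ := exists_mkOfW_eq x
  rw [rTensorMap_mkOfW, homRightMap_mkOfW, homRightMap_mkOfW]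
  exact pushoutMapW_mkOfW_eq_pullbackMapW_mkOfW (E.rTensorHomRightToHomRightHom C C'')

/-- **`Hom(x, Hom(C, C'')) = uncurry^* curry_* Hom(x ⊗ C, C'')`.** [cite: DeligneMilne1982Tannakian, §1 (1.6.3)] -/
theorem homRightMap_hom_eq (x : Ext A B) :
    homRightMap (hom C C'') x =
      pullbackMapW (homTensorUncurry B C C'')
        (pushoutMapW (homTensorCurry A C C'') (homRightMap C'' (rTensorMap C x))) := by
  rw [pushoutMapW_homTensorCurry_homRightMap_rTensorMap, ← pullbackMapW_comp, homTensorCurry_comp_homTensorUncurry,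
    pullbackMapW_id]

/-- **`Hom(x ⊗ C, C'') = curry^* uncurry_* Hom(x, Hom(C, C''))`.** [cite: DeligneMilne1982Tannakian, §1 (1.6.3)] -/
theorem homRightMap_rTensorMap_eq (x : Ext A B) :
    homRightMap C'' (rTensorMap C x) =
      pullbackMapW (homTensorCurry B C C'')
        (pushoutMapW (homTensorUncurry A C C'') (homRightMap (hom C C'') x)) := by
  rw [← pushoutMapW_pullbackMapW, ← pushoutMapW_homTensorCurry_homRightMap_rTensorMap, ← pushoutMapW_comp,
    homTensorUncurry_comp_homTensorCurry, pushoutMapW_id]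

end Ext

end Curry

/-! ### §3 `Hom(ℚ(0), E) ≅ E` -/

section UnitHom

variable {VE : Type*} [AddCommGroup VE] [Module ℚ VE] [FiniteDimensional ℚ VE]
variable {A : MixedHodgeStructure VA} {B : MixedHodgeStructure VB}

namespace Extension

variable (E : Extension A B VE)

/-- **The isomorphism of extensions `Hom(ℚ(0), E) → E`** over `Hom(ℚ(0), B) ≅ B`, `Hom(ℚ(0), A) ≅ A` (all
components `unitHomEval`, `f ↦ f(1)`; `(i ∘ f)(1) = i(f(1))`). [cite: DeligneMilne1982Tannakian, §1 (1.6.4)] -/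
def homLeftUnitToSelf : Morphism (E.homLeft (tate 0).toMixedHodgeStructure) E where
  left := unitHomEval B
  mid := unitHomEval E.mhs
  right := unitHomEval A
  mid_inc := by
    change (unitHomEval E.mhs).toLinearMap ∘ₗ (Hom.homMap (Hom.id (tate 0).toMixedHodgeStructure) E.inc).toLinearMap =
      E.inc.toLinearMap ∘ₗ (unitHomEval B).toLinearMap
    refine LinearMap.ext fun f => ?_
    simp only [LinearMap.comp_apply, unitHomEval_toLinearMap_apply, Hom.homMap_toLinearMap_apply,
      Hom.id_toLinearMap, LinearMap.comp_id]
  proj_mid := by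
    change E.proj.toLinearMap ∘ₗ (unitHomEval E.mhs).toLinearMap =
      (unitHomEval A).toLinearMap ∘ₗ (Hom.homMap (Hom.id (tate 0).toMixedHodgeStructure) E.proj).toLinearMap
    refine LinearMap.ext fun f => ?_
    simp only [LinearMap.comp_apply, unitHomEval_toLinearMap_apply, Hom.homMap_toLinearMap_apply,
      Hom.id_toLinearMap, LinearMap.comp_id]

/-- Components of `Hom(ℚ(0), E) → E` (by `rfl`). [cite: DeligneMilne1982Tannakian, §1 (1.6.4)] -/
@[simp]
theorem homLeftUnitToSelf_left : E.homLeftUnitToSelf.left = unitHomEval B := rfl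

/-- Components of `Hom(ℚ(0), E) → E` (by `rfl`). [cite: DeligneMilne1982Tannakian, §1 (1.6.4)] -/
@[simp]
theorem homLeftUnitToSelf_right : E.homLeftUnitToSelf.right = unitHomEval A := rfl

/-- **`(Hom(ℚ(0), B) ≅ B)_* Hom(ℚ(0), E) ≡ (Hom(ℚ(0), A) ≅ A)^* E`.** [cite: MacLane1963Homology, Ch. III Prop. 1.8]
[cite: DeligneMilne1982Tannakian, §1 (1.6.4)] -/
theorem nonempty_congruence_homLeft_unit_pushout_pullback :
    Nonempty (Congruence ((E.homLeft (tate 0).toMixedHodgeStructure).pushout (unitHomEval B))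
      (E.pullback (unitHomEval A))) :=
  nonempty_congruence_pushout_pullback_of_morphism E.homLeftUnitToSelf

/-- In the complete invariant: `(≅)_* [Hom(ℚ(0), E)]_W = (≅)^* [E]_W`. [cite: MacLane1963Homology, Ch. III Prop. 1.8] -/
theorem postcomp_clsW_homLeft_unit_eq_precomp_clsW :
    JHomW.postcomp (hom (tate 0).toMixedHodgeStructure A) (unitHomEval B)
        (E.homLeft (tate 0).toMixedHodgeStructure).clsW =
      JHomW.precomp B (unitHomEval A) E.clsW :=
  E.homLeftUnitToSelf.postcomp_clsW_eq_precomp_clsW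

/-- **`Hom(ℚ(0), E)` splits iff `E` splits.** [cite: DeligneMilne1982Tannakian, §1 (1.6.4)] -/
theorem isSplit_homLeft_unit_iff : (E.homLeft (tate 0).toMixedHodgeStructure).IsSplit ↔ E.IsSplit := by
  rw [← Ext.mkOfW_eq_zeroW_iff, ← Ext.mkOfW_eq_zeroW_iff]
  have h := Ext.pushoutMapW_mkOfW_eq_pullbackMapW_mkOfW E.homLeftUnitToSelf
  rw [homLeftUnitToSelf_left, homLeftUnitToSelf_right] at h
  constructor
  · intro h0
    have h1 : Ext.pullbackMapW (unitHomEval A) (Ext.mkOfW E) = Ext.zeroW := by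
      rw [← h, h0, Ext.pushoutMapW_zeroW]
    have h2 := congrArg (Ext.pullbackMapW (unitHomEvalInv A)) h1
    rwa [← Ext.pullbackMapW_comp, unitHomEval_comp_unitHomEvalInv, Ext.pullbackMapW_id,
      Ext.pullbackMapW_zeroW] at h2
  · intro h0
    have h1 : Ext.pushoutMapW (unitHomEval B) (Ext.mkOfW (E.homLeft (tate 0).toMixedHodgeStructure)) =
        Ext.zeroW := by
      rw [h, h0, Ext.pullbackMapW_zeroW]
    have h2 := congrArg (Ext.pushoutMapW (unitHomEvalInv B)) h1
    rwa [← Ext.pushoutMapW_comp, unitHomEvalInv_comp_unitHomEval, Ext.pushoutMapW_id,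
      Ext.pushoutMapW_zeroW] at h2

end Extension

namespace Ext

/-- **`(Hom(ℚ(0), B) ≅ B)_* Hom(ℚ(0), x) = (Hom(ℚ(0), A) ≅ A)^* x`** on `Ext`: `Hom(ℚ(0), −)` is the identity up
to the unit isomorphisms. [cite: DeligneMilne1982Tannakian, §1 (1.6.4)] [cite: MacLane1963Homology, Ch. III Prop. 1.8] -/
theorem pushoutMapW_unitHomEval_homLeftMap (x : Ext A B) :
    pushoutMapW (unitHomEval B) (homLeftMap (tate 0).toMixedHodgeStructure x) = pullbackMapW (unitHomEval A) x := by
  obtain ⟨E, rfl⟩ := exists_mkOfW_eq x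
  rw [homLeftMap_mkOfW]
  exact pushoutMapW_mkOfW_eq_pullbackMapW_mkOfW E.homLeftUnitToSelf

/-- **`Hom(ℚ(0), x) = (Hom(ℚ(0), A) ≅ A)^* (B ≅ Hom(ℚ(0), B))_* x`.** [cite: DeligneMilne1982Tannakian, §1 (1.6.4)] -/
theorem homLeftMap_unit_eq (x : Ext A B) :
    homLeftMap (tate 0).toMixedHodgeStructure x =
      pullbackMapW (unitHomEval A) (pushoutMapW (unitHomEvalInv B) x) := by
  rw [← pushoutMapW_pullbackMapW, ← pushoutMapW_unitHomEval_homLeftMap, ← pushoutMapW_comp,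
    unitHomEvalInv_comp_unitHomEval, pushoutMapW_id]

/-- **`x = (A ≅ Hom(ℚ(0), A))^* (Hom(ℚ(0), B) ≅ B)_* Hom(ℚ(0), x)`.** [cite: DeligneMilne1982Tannakian, §1 (1.6.4)] -/
theorem eq_pullbackMapW_pushoutMapW_homLeftMap_unit (x : Ext A B) :
    x = pullbackMapW (unitHomEvalInv A)
      (pushoutMapW (unitHomEval B) (homLeftMap (tate 0).toMixedHodgeStructure x)) := by
  rw [pushoutMapW_unitHomEval_homLeftMap, ← pullbackMapW_comp, unitHomEval_comp_unitHomEvalInv, pullbackMapW_id]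

/-- `Hom(ℚ(0), −)` is injective on `Ext(A, B)`. [cite: DeligneMilne1982Tannakian, §1 (1.6.4)] -/
theorem homLeftMap_unit_injective :
    Function.Injective (homLeftMap (A := A) (B := B) (tate 0).toMixedHodgeStructure) := by
  intro x y h
  rw [eq_pullbackMapW_pushoutMapW_homLeftMap_unit x, eq_pullbackMapW_pushoutMapW_homLeftMap_unit y, h]

/-- `Hom(ℚ(0), x)` splits iff `x` splits. [cite: DeligneMilne1982Tannakian, §1 (1.6.4)] -/
theorem homLeftMap_unit_eq_zeroW_iff (x : Ext A B) :
    homLeftMap (tate 0).toMixedHodgeStructure x = zeroW ↔ x = zeroW := by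
  obtain ⟨E, rfl⟩ := exists_mkOfW_eq x
  rw [homLeftMap_mkOfW, mkOfW_eq_zeroW_iff, mkOfW_eq_zeroW_iff, Extension.isSplit_homLeft_unit_iff]

end Ext

end UnitHom

end MixedHodgeStructure

end Literature.AlgebraicGeometry.Motives

end
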